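import Literature.NumberTheory.LFunctions.Zhang2022.TypedSection01and02A
import Literature.NumberTheory.LFunctions.Zhang2022.KnifeEdgeEStarLen
import Literature.NumberTheory.LFunctions.Zhang2022.KnifeEdgeNuOverhang
import Literature.NumberTheory.LFunctions.Zhang2022.KnifeEdgeEq148DUniform
import Literature.NumberTheory.LFunctions.Zhang2022.RepairGramBlock
import Literature.NumberTheory.LFunctions.Zhang2022.KnifeEdgeEllVernierVacuity

/-!
# Zhang (2022) repair catalogue: (A)-guarded hypotheses are consequences of the classical conjecture
# (why the kernel cannot refute an `⟨A⟩`-guarded row — and what a refutation would prove instead)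

Trunk T-ANT (NumberTheory/LFunctions). Y. Zhang, *Discrete mean estimates and the Landau–Siegel zero*,
arXiv:2211.02515v1 [Zhang2022LandauSiegel] — an unrefereed manuscript under adjudication; **nothing in this file
asserts or denies its Theorems 1–2**, and nothing here is a claim about Landau–Siegel zeros. Cell landau-siegel,
D-0124 LS RESCUE (2) repair catalogue (refuter seat ls-rescue-ref-1), battery step T5 «(A)-guarded vacuity».

Every design-facing hypothesis of the cell's registry is typed in the manuscript's standing dialect
`ForAllLarge (fun D χ => AssumptionA D χ → …)` (§2 p. 4: «Assume that (A) holds … for `D` greater than a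
sufficiently large number»): `KnifeEdge.EStarLen` (E-001), `KnifeEdge.NuMeanInvisible` (E-074′),
`KnifeEdge.GramDictionary`, `KnifeEdge.Eq148DUniform` (E-016), … . This file records, once, the bookkeeping the
catalogue cites for all of them:

* `notAEventually_of_lOneLowerBound` — any effective lower bound `L(1,χ) > c₁(log D)^{−A}` with `A < 2022`
  makes (A) (`‖L(1,χ)‖ < (log D)^{−2022}`) fail for every large modulus; in particular
  `notAEventually_of_noSiegelZeros` — the classical conjecture `NoSiegelZeros` (via (1.1), `Section1.eq11Imp_holds`)
  does.
* «¬(A) eventually» proves every (A)-guarded eventual statement outright (the tree's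
  `KnifeEdgeEll.Vernier.forAllLarge_guarded_of_notA`, reused); hence `guarded_of_noSiegelZeros`,
  `not_noSiegelZeros_of_not_guarded` / `not_lOneLowerBound_of_not_guarded`: **a kernel refutation of ANY
  (A)-guarded row would be a kernel DISPROOF of `NoSiegelZeros`** (and of every `LOneLowerBound A`, `A < 2022`).
  Such rows are therefore excluded from refutation by construction; their currency is the gap table (price of
  the input), never a `¬`-theorem.
* Named instances for the registry rows: `eStarLen_of_noSiegelZeros` (E-001, `0 < δ`),
  `nuMeanInvisible_of_noSiegelZeros` (E-074′, `1 < θ`), `gramDictionary_of_noSiegelZeros`,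
  `eq148DUniform_of_noSiegelZeros` (E-016, design-facing form; the priced twin `Eq148DUniformUncond` is NOT
  guarded and is not covered here).

Scope: statements guarded by (b) «every sampled zero has `Re ρ = ½`» instead of (A) (`Repair.BandMeanValue`,
`Repair.DiscMeanTrueBand`, …) are not covered: (b) is a consequence of (A) only through Prop. 2.2 (i), an open node.
The programme SEARCHES and TYPES; no claim about Landau–Siegel zeros, Theorems 1–2 of arXiv:2211.02515 or a
repaired Margin232 until a kernel theorem says so.
-/

noncomputable section

namespace Literature.NumberTheory.LFunctions.Zhang2022.Repair.Guarded

open Literature.NumberTheory.LFunctions.Zhang2022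
open Literature.NumberTheory.LFunctions.Zhang2022.Skeleton
open Real

/-! ## Part 1 — effective lower bounds for `L(1,χ)` switch (A) off eventually -/

/-- **`LOneLowerBound A` with `A < 2022` gives «¬(A) for every large modulus»**: from `‖L(1,χ)‖ > c₁(log D)^{−A}`
and `log D ≥ max(1, 1/c₁)` we get `c₁(log D)^{−A} ≥ (log D)^{−2022}`, so `‖L(1,χ)‖ < (log D)^{−2022}` fails.
[cite: Zhang2022LandauSiegel, §2 Assumption (A) p. 4; §1 Theorem 1] -/
theorem notAEventually_of_lOneLowerBound {A : ℕ} (hA : A < 2022) (h : LOneLowerBound A) :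
    ForAllLarge fun D _ χ => ¬ AssumptionA D χ := by
  obtain ⟨c₁, hc₁, hL⟩ := h
  refine ⟨max 3 ⌈Real.exp (max 1 (1 / c₁))⌉₊, fun D _ χ hD hq hp hA' => ?_⟩
  have hD3 : 3 ≤ D := le_trans (le_max_left _ _) hD
  have hDexp : Real.exp (max 1 (1 / c₁)) ≤ (D : ℝ) := by
    have h1 : (⌈Real.exp (max 1 (1 / c₁))⌉₊ : ℝ) ≤ (D : ℝ) := by
      exact_mod_cast le_trans (le_max_right _ _) hD
    exact le_trans (Nat.le_ceil _) h1
  have hDpos : (0 : ℝ) < D := by exact_mod_cast lt_of_lt_of_le (by norm_num : 0 < 3) hD3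
  have hlog : max 1 (1 / c₁) ≤ Real.log D := by
    have := Real.log_le_log (Real.exp_pos _) hDexp
    rwa [Real.log_exp] at this
  have hlog1 : 1 ≤ Real.log D := le_trans (le_max_left _ _) hlog
  have hlogc : 1 / c₁ ≤ Real.log D := le_trans (le_max_right _ _) hlog
  have hlogpos : 0 < Real.log D := lt_of_lt_of_le one_pos hlog1
  have hlow := hL D χ hD3 hq hp
  -- `(log D)^{-2022} ≤ c₁ (log D)^{-A}`
  have hkey : 1 / Real.log D ^ 2022 ≤ c₁ / Real.log D ^ A := by
    rw [div_le_div_iff₀ (pow_pos hlogpos _) (pow_pos hlogpos _), one_mul]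
    obtain ⟨k, hk⟩ := Nat.exists_eq_add_of_lt hA
    have hk' : 2022 = A + (k + 1) := by omega
    rw [hk', pow_add]
    have h1 : 1 ≤ c₁ * Real.log D ^ (k + 1) := by
      have hck : 1 ≤ c₁ * Real.log D := by
        have := mul_le_mul_of_nonneg_left hlogc hc₁.le
        rwa [mul_one_div_cancel hc₁.ne'] at this
      calc (1 : ℝ) ≤ c₁ * Real.log D := hck
        _ = c₁ * Real.log D ^ 1 := by rw [pow_one]
        _ ≤ c₁ * Real.log D ^ (k + 1) :=
            mul_le_mul_of_nonneg_left (pow_le_pow_right₀ hlog1 (by omega)) hc₁.le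
    have h2 := mul_le_mul_of_nonneg_left h1 (pow_pos hlogpos A).le
    calc Real.log D ^ A = Real.log D ^ A * 1 := by ring
      _ ≤ Real.log D ^ A * (c₁ * Real.log D ^ (k + 1)) := h2
      _ = c₁ * (Real.log D ^ A * Real.log D ^ (k + 1)) := by ring
  have hA'' : ‖χ.LFunction 1‖ < 1 / Real.log D ^ 2022 := hA'
  exact lt_irrefl _ (((lt_of_le_of_lt hkey hlow)).trans hA'')

/-- **The classical conjecture switches (A) off eventually**: `NoSiegelZeros` gives (1.1)
(`Section1.eq11Imp_holds`: `LOneLowerBound 1`), hence «¬(A) for every large modulus».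
[cite: Zhang2022LandauSiegel, §1 (1.1) p. 2; §2 Assumption (A) p. 4] -/
theorem notAEventually_of_noSiegelZeros (h : NoSiegelZeros) : ForAllLarge fun D _ χ => ¬ AssumptionA D χ :=
  notAEventually_of_lOneLowerBound (by norm_num) (Section1.eq11Imp_holds h)

/-! ## Part 2 — (A)-guarded eventual statements: vacuity and what a refutation would prove -/

/-- Every (A)-guarded eventual statement is a consequence of `NoSiegelZeros`.
[cite: Zhang2022LandauSiegel, §1 (1.1) p. 2; §2 p. 4] -/
theorem guarded_of_noSiegelZeros {S : (D : ℕ) → [NeZero D] → DirichletCharacter ℂ D → Prop}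
    (h : NoSiegelZeros) : ForAllLarge fun D _ χ => AssumptionA D χ → S D χ :=
  KnifeEdgeEll.Vernier.forAllLarge_guarded_of_notA (notAEventually_of_noSiegelZeros h)

/-- **What a refutation of an (A)-guarded row would be**: a kernel proof of `¬ NoSiegelZeros`.
[cite: Zhang2022LandauSiegel, §1 (1.1) p. 2; §2 p. 4] -/
theorem not_noSiegelZeros_of_not_guarded {S : (D : ℕ) → [NeZero D] → DirichletCharacter ℂ D → Prop}
    (h : ¬ ForAllLarge fun D _ χ => AssumptionA D χ → S D χ) : ¬ NoSiegelZeros :=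
  fun hNS => h (guarded_of_noSiegelZeros hNS)

/-- … and of `¬ LOneLowerBound A` for every `A < 2022` (in particular of `¬ Theorem1`'s stronger cousins
`LOneLowerBound A`, `A ≤ 2021`). [cite: Zhang2022LandauSiegel, §1 Theorem 1; §2 p. 4] -/
theorem not_lOneLowerBound_of_not_guarded {S : (D : ℕ) → [NeZero D] → DirichletCharacter ℂ D → Prop}
    (h : ¬ ForAllLarge fun D _ χ => AssumptionA D χ → S D χ) {A : ℕ} (hA : A < 2022) :
    ¬ LOneLowerBound A :=
  fun hL => h (KnifeEdgeEll.Vernier.forAllLarge_guarded_of_notA (notAEventually_of_lOneLowerBound hA hL))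

/-! ## Part 3 — the registry rows, named -/

/-- E-001 `EStarLen c′ δ O` (any pair functional `O`, any `δ > 0`) follows from `NoSiegelZeros`.
[cite: Zhang2022LandauSiegel, §7 Prop 7.1 (7.2), §8 (8.23)] -/
theorem eStarLen_of_noSiegelZeros (h : NoSiegelZeros) {c' δ : ℝ} (hδ : 0 < δ) (O : KnifeEdge.PairFunctional) :
    KnifeEdge.EStarLen c' δ O :=
  ⟨hδ, fun _ _ _ _ _ => guarded_of_noSiegelZeros h⟩

/-- E-074′ `NuMeanInvisible c′ θ 𝒱 S` (any class `𝒱`, any scale `S`, any `θ > 1`) follows from `NoSiegelZeros`.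
[cite: Zhang2022LandauSiegel, §7 (7.2) p. 44] -/
theorem nuMeanInvisible_of_noSiegelZeros (h : NoSiegelZeros) {c' θ : ℝ} (hθ : 1 < θ)
    (𝒱 : (ℝ → ℂ) → (ℝ → ℂ) → Prop) (S : KnifeEdge.Scale) : KnifeEdge.NuMeanInvisible c' θ 𝒱 S :=
  ⟨hθ, fun _ _ _ _ _ => guarded_of_noSiegelZeros h⟩

/-- `GramDictionary c′ T G` (any table family `T`, ANY matrix `G`) follows from `NoSiegelZeros` — under the
classical conjecture every dictionary is «true», which is why no dictionary row is refutable.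
[cite: Zhang2022LandauSiegel, §2 (2.16)–(2.17), §8 (8.3)] -/
theorem gramDictionary_of_noSiegelZeros (h : NoSiegelZeros) {c' : ℝ} {ι : Type*} [Fintype ι]
    (T : ι → ((D : ℕ) → DirichletCharacter ℂ D → (Skeleton.Chr D → ℂ → ℂ))) (G : Matrix ι ι ℂ) :
    KnifeEdge.GramDictionary c' T G :=
  fun _ _ => guarded_of_noSiegelZeros h

/-- E-016 (design-facing form) `Eq148DUniform A B` (any `A`, `B`) follows from `NoSiegelZeros`
(witness constants `c = 1`, `C = 0`). The priced twin `Eq148DUniformUncond` carries no guard and is NOT covered.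
[cite: Zhang2022LandauSiegel, §14 (14.8) p. 79] -/
theorem eq148DUniform_of_noSiegelZeros (h : NoSiegelZeros) (A B : ℝ) : KnifeEdge.Eq148DUniform A B :=
  fun _ => ⟨1, one_pos, 0, guarded_of_noSiegelZeros h⟩

end Literature.NumberTheory.LFunctions.Zhang2022.Repair.Guarded

end
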